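import Literature.AnabelianGeometry.EtaleTheta.Discharge.Sec3BLambdaInjectiveOfGaloisCoveringConnected
import Literature.AnabelianGeometry.EtaleTheta.Discharge.Sec3Prop34iPhiZero
import Mathlib.CategoryTheory.InducedCategory

/-!
# [EtTh] Def. 3.3 (iii), step 4: whiskering Def. 3.3 (iii) data along a functor, and the SMALL coset model of `D₀`
# (objects = subgroups `H ⊆ G = Gal(Z^log_∞/X^log)`, i.e. the coverings `G/H`) — class (b) construction

S. Mochizuki, *The étale theta function …*, Publ. RIMS **45** (2009) [MochizukiEtTh2009], §3, p.72 «`D₀ := B^temp(X^log)⁰`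
… the full subcategory constituted by the connected objects», Def. 3.3 (iii) p.73 («for any connected tempered covering
`Y^log → X^log` … `Φ₀(Y^log) := lim Div⁺(Z^log_∞)^{Gal(Z^log_∞/Y^log)}`; `B₀(Y^log) := lim Mero(Z^log_∞)^{Gal(Z^log_∞/Y^log)}`»)
[cite: MochizukiEtTh2009, Def 3.3 p.73]; S. Mochizuki, *The geometry of Frobenioids II* (2008) [MochizukiFrdII2008],
Ex. 1.3 (i) p.11 («the set of cosets `Π/Π°` equipped with its natural `Π`-action»).

abc-iut cell, layer L2; seat abc-iut-w5-d179 (gen 5), SUBDAG-EtTh-Thm44 custodian lineage; CLASS (b) CONSTRUCTION under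
the post-freeze rules (2 `def`s, 0 structures / instances / notation / `Prop` facts; flagged to ref-d).  The frozen
`DivisorMonoids` (`DivisorMonoids.lean`), abc-iut-w6-d058's `DivisorMonoids.ofGaloisAction` / `.restrict` /
`.ofGaloisActionConnected` (`DivisorMonoidsOfGaloisCovering[Connected].lean`, p436511 / p437704), abc-iut-w6-d048's
`phiZeroPull_reflects_dvd` (p439556) and abc-iut-w6-d057's `isPerfFactorialCof_phiZero` (p436557) are consumed BY NAME.

WHY.  abc-iut-L2-t3's `BiKummerSetting X T D VD` ties the universe of the Def. 3.3 (iii) base `D₀` to that of the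
base field `K` (`{K : Type u₀} … {D₀ : Type u₀}`).  abc-iut-w6-d058's connected model
`ofGaloisActionConnected A hZ` lives over `D₀ = (isConnectedGSet).FullSubcategory ⊆ Action (Type u) G : Type (u+1)`, so
every [EtTh] Thm 4.4 instance over it needs `K : Type (u+1)` (`BiKummerThm44SubModelConnectedOfGaloisCovering.lean`,
p439044), and abc-iut-L2-t3's Thm 4.4 IN FULL with the Kummer-class clause (`Discharge/Sec4Thm44KummerClassConnected.lean`,
p439173 / p439960 — `K, Π^tp_X, D₀ : Type 0`, Mathlib `groupCohomology` at universe `0`) cannot instantiate there at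
all.  Print's `D₀` at one term of the limit is ESSENTIALLY SMALL: a connected covering dominated by `Z^log_∞` is `G/H`
for `H = Gal(Z^log_∞/Y^log) ⊆ G`.  This file provides that small model:

* `DivisorMonoids.precomp T F` — the Def. 3.3 (iii) data `T` over `D₀` whiskered along ANY functor `F : D₁ ⥤ D₀`
  (all functors and transformations precomposed with `F.op`; abc-iut-w6-d058's `restrict T P` is `precomp T P.ι`
  on the nose, `precomp_ι_eq_restrict`); general and reusable (base change of Def. 3.3 (iii) data);
* `DivisorMonoids.ofGaloisActionCoset A hZ := (ofGaloisAction A hZ).precomp (inducedFunctor (H ↦ G/H))` over the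
  COSET MODEL `InducedCategory (Action (Type u) G) (fun H : Subgroup G => Action.ofMulAction G (G ⧸ H))` (Mathlib:
  objects `Subgroup G : Type u`, morphisms = `G`-maps `G/H → G/H'`, `Hom`-universe `u`; its image consists of nonempty
  transitive `G`-sets, `isConnectedGSet_quotient`) — so `D₀ : Type u`, and `u := 0` is available;
* THEOREMS at the coset model: the transition maps of `B₀` / `Φ₀` are injective (`…Coset_B₀_map_injective`,
  `…_Φ₀_map_injective` — maps `G/H → G/H'` are onto), `Φ₀`'s reflect divisibility (`…_Φ₀_map_reflects_dvd`), every
  `Φ₀(G/H)` is weakly perf-factorial with cofinal perfection (`…_isPerfFactorialCof`, Prop. 3.4 (i) weak) — i.e. every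
  clause the L2 §3/§4 chain binds (`hBinj` at all six Def. 3.6 (i) constructors, `hΦinj`, `hΦrefl`, `hpf` weak) is a
  theorem here, exactly as over the connected model; NON-VACUITY at the toy model for every group.
HONEST FRAMING: a construction over the typed interfaces `LogDivisorModel` / `GaloisAction` / `CuspLaws` (one term of
Def. 3.3 (iii)'s inductive limit, Rmk. 3.3.1; nothing asserts they arise from an actual curve); no named Prop fact, no
instance, no sorry; nothing here bears on [IUTchIII] Cor. 3.12; typed ≠ proved.
-/

namespace Literature.AnabelianGeometry.EtaleTheta

open CategoryTheory Opposite Function Literature.AlgebraicGeometry.Frobenioids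

universe u v w u₁ v₁

/-! ## Whiskering Def. 3.3 (iii) data along a functor -/

namespace DivisorMonoids

variable {D₀ : Type u} [Category.{v} D₀] (T : DivisorMonoids.{u, v, w} D₀) {D₁ : Type u₁} [Category.{v₁} D₁]
  (F : D₁ ⥤ D₀)

/-- **Base change of Def. 3.3 (iii) data along a functor** `F : D₁ ⥤ D₀`: every functor and transformation of `T`
precomposed with `F.op` (`Φ₀ ∘ F`, `B₀ ∘ F`, `div₀`, `F₀`, the (non-)cuspidal parts and their laws at `F Y`).
abc-iut-w6-d058's `restrict T P` is the case `F = P.ι`. [cite: MochizukiEtTh2009, Def 3.3 p.73] -/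
noncomputable def precomp : DivisorMonoids.{u₁, v₁, w} D₁ where
  Φ₀ := F.op ⋙ T.Φ₀
  B₀ := F.op ⋙ T.B₀
  isUnit_B₀ Y b := T.isUnit_B₀ (op (F.obj Y.unop)) b
  div₀ Y := T.div₀ (op (F.obj Y.unop))
  div₀_natural f b := T.div₀_natural (F.map f.unop).op b
  F₀ Y := T.F₀ (op (F.obj Y.unop))
  F₀_map f b hb := T.F₀_map (F.map f.unop).op b hb
  ncsp₀ Y := T.ncsp₀ (op (F.obj Y.unop))
  csp₀ Y := T.csp₀ (op (F.obj Y.unop))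
  ncsp₀_map f x hx := T.ncsp₀_map (F.map f.unop).op x hx
  csp₀_map f x hx := T.csp₀_map (F.map f.unop).op x hx
  existsUnique_ncsp_csp Y x := T.existsUnique_ncsp_csp (op (F.obj Y.unop)) x

/-- `Φ₀` of the base change, on objects. [cite: MochizukiEtTh2009, Def 3.3 p.73] -/
theorem precomp_Φ₀_obj (Y : D₁ᵒᵖ) : (T.precomp F).Φ₀.obj Y = T.Φ₀.obj (op (F.obj Y.unop)) := rfl

/-- `B₀` of the base change, on objects. [cite: MochizukiEtTh2009, Def 3.3 p.73] -/
theorem precomp_B₀_obj (Y : D₁ᵒᵖ) : (T.precomp F).B₀.obj Y = T.B₀.obj (op (F.obj Y.unop)) := rfl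

/-- `Φ₀` of the base change, on morphisms. [cite: MochizukiEtTh2009, Def 3.3 p.73] -/
theorem precomp_Φ₀_map {Y Y' : D₁ᵒᵖ} (f : Y ⟶ Y') : (T.precomp F).Φ₀.map f = T.Φ₀.map (F.map f.unop).op := rfl

/-- `B₀` of the base change, on morphisms. [cite: MochizukiEtTh2009, Def 3.3 p.73] -/
theorem precomp_B₀_map {Y Y' : D₁ᵒᵖ} (f : Y ⟶ Y') : (T.precomp F).B₀.map f = T.B₀.map (F.map f.unop).op := rfl

/-- `div₀` of the base change. [cite: MochizukiEtTh2009, Def 3.3 p.73] -/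
theorem precomp_div₀ (Y : D₁ᵒᵖ) : (T.precomp F).div₀ Y = T.div₀ (op (F.obj Y.unop)) := rfl

/-- `F₀` of the base change. [cite: MochizukiEtTh2009, Def 3.3 p.73] -/
theorem precomp_F₀ (Y : D₁ᵒᵖ) : (T.precomp F).F₀ Y = T.F₀ (op (F.obj Y.unop)) := rfl

/-- `ncsp₀` of the base change. [cite: MochizukiEtTh2009, Def 3.3 p.73] -/
theorem precomp_ncsp₀ (Y : D₁ᵒᵖ) : (T.precomp F).ncsp₀ Y = T.ncsp₀ (op (F.obj Y.unop)) := rfl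

/-- `csp₀` of the base change. [cite: MochizukiEtTh2009, Def 3.3 p.73] -/
theorem precomp_csp₀ (Y : D₁ᵒᵖ) : (T.precomp F).csp₀ Y = T.csp₀ (op (F.obj Y.unop)) := rfl

/-- **abc-iut-w6-d058's restriction to a full subcategory IS the base change along the inclusion** `P.ι` —
definitionally. [cite: MochizukiEtTh2009, Def 3.3 p.73] -/
theorem precomp_ι_eq_restrict (P : ObjectProperty D₀) : T.precomp P.ι = T.restrict P := rfl

/-- Prop. 3.4 (ii)'s typed fields descend along any base change (cf. `restrict_prop34_ii`).
[cite: MochizukiEtTh2009, Prop 3.4 p.74] -/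
theorem precomp_prop34_ii (hker : ∀ (Y : D₀ᵒᵖ) (b : T.B₀.obj Y), T.div₀ Y b = 1 → b ∈ T.F₀ Y)
    (heff : ∀ (Y : D₀ᵒᵖ) (b : T.B₀.obj Y) (x : T.Φ₀.obj Y),
      T.div₀ Y b = Algebra.GrothendieckGroup.of x → b ∈ T.F₀ Y) :
    (∀ (Y : D₁ᵒᵖ) (b : (T.precomp F).B₀.obj Y), (T.precomp F).div₀ Y b = 1 → b ∈ (T.precomp F).F₀ Y) ∧
      ∀ (Y : D₁ᵒᵖ) (b : (T.precomp F).B₀.obj Y) (x : (T.precomp F).Φ₀.obj Y),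
        (T.precomp F).div₀ Y b = Algebra.GrothendieckGroup.of x → b ∈ (T.precomp F).F₀ Y :=
  ⟨fun _ b h => hker _ b h, fun _ b x h => heff _ b x h⟩

/-- Injectivity of the transition maps of `B₀` descends along any base change (it is a property of the maps `T.B₀.map`
at the images). [cite: MochizukiEtTh2009, Def 3.3 p.73] -/
theorem precomp_B₀_map_injective (hB : ∀ {Y Y' : D₀ᵒᵖ} (g : Y ⟶ Y'), Injective (T.B₀.map g).hom)
    {Y Y' : D₁ᵒᵖ} (f : Y ⟶ Y') : Injective ((T.precomp F).B₀.map f).hom :=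
  hB (F.map f.unop).op

/-- Injectivity of the transition maps of `Φ₀` descends along any base change. [cite: MochizukiEtTh2009, Def 3.3 p.73] -/
theorem precomp_Φ₀_map_injective (hΦ : ∀ {Y Y' : D₀ᵒᵖ} (g : Y ⟶ Y'), Injective (T.Φ₀.map g).hom)
    {Y Y' : D₁ᵒᵖ} (f : Y ⟶ Y') : Injective ((T.precomp F).Φ₀.map f).hom :=
  hΦ (F.map f.unop).op

end DivisorMonoids

/-! ## The coset model of `D₀`: the coverings `G/H`, `H ⊆ G = Gal(Z^log_∞/X^log)` -/

namespace LogDivisorModel.GaloisAction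

variable (G : Type u) [Group G]

/-- **The coverings `G/H` as `G`-sets** — the object map of the coset model: `H ↦ G/H` with its natural left
`G`-action ([FrdII] Ex. 1.3 (i) «the set of cosets `Π/Π°` equipped with its natural `Π`-action»; at one term of the
Def. 3.3 (iii) limit every connected covering `Y^log` of `X^log` dominated by `Z^log_∞` is `G/Gal(Z^log_∞/Y^log)`).
The coset model of `D₀` is Mathlib's `InducedCategory (Action (Type u) G) (cosetGSet G)`: objects `Subgroup G`,
morphisms the `G`-maps `G/H → G/H'`. [cite: MochizukiEtTh2009, Def 3.3 p.73] -/
def cosetGSet : Subgroup G → Action (Type u) G := fun H => Action.ofMulAction G (G ⧸ H)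

/-- The `G`-set of `H` in the coset model is `G/H`. [cite: MochizukiEtTh2009, Def 3.3 p.73] -/
theorem cosetGSet_apply (H : Subgroup G) : cosetGSet G H = Action.ofMulAction G (G ⧸ H) := rfl

/-- Every object of the coset model is a CONNECTED covering (nonempty transitive `G`-set).
[cite: MochizukiEtTh2009, Def 3.3 p.73] -/
theorem isConnectedGSet_cosetGSet (H : Subgroup G) : isConnectedGSet (cosetGSet G H) :=
  isConnectedGSet_quotient H

/-- Every morphism of the coset model is a SURJECTIVE covering map `G/H ↠ G/H'`.
[cite: MochizukiEtTh2009, Def 3.3 p.73] -/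
theorem hom_surjective_cosetGSet {H H' : InducedCategory (Action (Type u) G) (cosetGSet G)} (f : H ⟶ H') :
    Function.Surjective f.hom.hom :=
  hom_surjective_of_isConnectedGSet (isConnectedGSet_cosetGSet G H) (isConnectedGSet_cosetGSet G H') f.hom

end LogDivisorModel.GaloisAction

namespace DivisorMonoids

open LogDivisorModel.GaloisAction

variable {Z : LogDivisorModel.{u}} {G : Type u} [Group G] (A : Z.GaloisAction G) (hZ : Z.CuspLaws)

/-- **Def. 3.3 (iii) data over the SMALL coset model of `D₀`** — the base change of abc-iut-w6-d058's
`ofGaloisAction A hZ` along `inducedFunctor (cosetGSet G) : (coset model) ⥤ Action (Type u) G`: at the object `H`,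
`Φ₀ = Hom_G(G/H, Div⁺(Z^log_∞)) = Div⁺(Z^log_∞)^H`, `B₀ = Mero(Z^log_∞)^H`, `div₀`, `F₀`, … as constructed there.
The base has objects `Subgroup G : Type u` and `Hom`-universe `u`. [cite: MochizukiEtTh2009, Def 3.3 p.73] -/
noncomputable def ofGaloisActionCoset :
    DivisorMonoids.{u, u, u} (InducedCategory (Action (Type u) G) (cosetGSet G)) :=
  (ofGaloisAction A hZ).precomp (inducedFunctor (cosetGSet G))

/-- It IS the base change (by definition). [cite: MochizukiEtTh2009, Def 3.3 p.73] -/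
theorem ofGaloisActionCoset_eq :
    ofGaloisActionCoset A hZ = (ofGaloisAction A hZ).precomp (inducedFunctor (cosetGSet G)) := rfl

/-- `Φ₀(H)` of the coset model is `Hom_G(G/H, Div⁺(Z^log_∞))`. [cite: MochizukiEtTh2009, Def 3.3 p.73] -/
theorem ofGaloisActionCoset_Φ₀_obj (H : (InducedCategory (Action (Type u) G) (cosetGSet G))ᵒᵖ) :
    (ofGaloisActionCoset A hZ).Φ₀.obj H = A.PhiZero.obj (op (cosetGSet G H.unop)) := rfl

/-- `B₀(H)` of the coset model is `Hom_G(G/H, Mero(Z^log_∞))`. [cite: MochizukiEtTh2009, Def 3.3 p.73] -/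
theorem ofGaloisActionCoset_B₀_obj (H : (InducedCategory (Action (Type u) G) (cosetGSet G))ᵒᵖ) :
    (ofGaloisActionCoset A hZ).B₀.obj H = A.BZero.obj (op (cosetGSet G H.unop)) := rfl

/-- **The transition maps of `B₀` are injective over the coset model** (inclusions `Mero(Z_∞)^H ↪ Mero(Z_∞)^{H'}`):
the Def. 3.6 (i) binder `hBinj` at `Λ ∈ {ℤ, ℚ}` holds here (cf. `ofGaloisActionConnected_B₀_map_injective`).
[cite: MochizukiEtTh2009, Def 3.3 p.73] -/
theorem ofGaloisActionCoset_B₀_map_injective {Y Y' : (InducedCategory (Action (Type u) G) (cosetGSet G))ᵒᵖ}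
    (f : Y ⟶ Y') : Function.Injective ((ofGaloisActionCoset A hZ).B₀.map f).hom :=
  A.bZeroPull_injective f.unop.hom (hom_surjective_cosetGSet G f.unop)

/-- **The transition maps of `Φ₀` are injective over the coset model.** [cite: MochizukiEtTh2009, Def 3.3 p.73] -/
theorem ofGaloisActionCoset_Φ₀_map_injective {Y Y' : (InducedCategory (Action (Type u) G) (cosetGSet G))ᵒᵖ}
    (f : Y ⟶ Y') : Function.Injective ((ofGaloisActionCoset A hZ).Φ₀.map f).hom :=
  A.phiZeroPull_injective f.unop.hom (hom_surjective_cosetGSet G f.unop)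

/-- **The transition maps of `Φ₀` reflect divisibility over the coset model** (abc-iut-w6-d048's
`phiZeroPull_reflects_dvd` along the surjections `G/H ↠ G/H'`): the clause `hΦrefl` of the `Λ = ℝ` route holds here.
[cite: MochizukiEtTh2009, Def 3.3 p.73] -/
theorem ofGaloisActionCoset_Φ₀_map_reflects_dvd {Y Y' : (InducedCategory (Action (Type u) G) (cosetGSet G))ᵒᵖ}
    (f : Y ⟶ Y') (a b : (ofGaloisActionCoset A hZ).Φ₀.obj Y)
    (h : ((ofGaloisActionCoset A hZ).Φ₀.map f).hom a ∣ ((ofGaloisActionCoset A hZ).Φ₀.map f).hom b) : a ∣ b :=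
  A.phiZeroPull_reflects_dvd f.unop.hom (hom_surjective_cosetGSet G f.unop) a b h

/-- **Prop. 3.4 (i), weak with cofinal perfection, for every `Φ₀(G/H)` of the coset model** (abc-iut-w6-d057's
`isPerfFactorialCof_phiZero`): the `hpf` slot of `ofRlfZWeak` / `ofRlfQWeak` / `ofRlfRWeak` here, PROVED.
[cite: MochizukiEtTh2009, Prop 3.4 p.74] -/
theorem ofGaloisActionCoset_isPerfFactorialCof (Y : (InducedCategory (Action (Type u) G) (cosetGSet G))ᵒᵖ) :
    IsPerfFactorialCof ((ofGaloisActionCoset A hZ).Φ₀.obj Y) :=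
  A.isPerfFactorialCof_phiZero (cosetGSet G Y.unop)

/-- **Non-vacuity**: the coset-model construction applies to the trivial action of any group on
`LogDivisorModel.toy`. [cite: MochizukiEtTh2009, Def 3.3 p.73] -/
theorem nonempty_ofGaloisActionCoset_toy (G : Type) [Group G] :
    Nonempty (DivisorMonoids.{0, 0, 0} (InducedCategory (Action (Type 0) G) (cosetGSet G))) :=
  ⟨ofGaloisActionCoset (LogDivisorModel.GaloisAction.trivial LogDivisorModel.toy G) LogDivisorModel.cuspLaws_toy⟩

end DivisorMonoids

end Literature.AnabelianGeometry.EtaleTheta
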